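import Mathlib
import HarnessLib
import Literature.MathematicalPhysics.StatisticalMechanics.WeightDataGeometry
import Literature.MathematicalPhysics.StatisticalMechanics.TorusMultiplierKernels
import Literature.MathematicalPhysics.StatisticalMechanics.TorusBlocks

/-!
# The weight data of [ABKM19] Ch. 7 on the torus: radii, indicator weights, and the geometric
# half of Theorem 7.1 (Lemma 7.5 (iii),(iv), Lemma 7.6) for `L ≥ 2^{d+3} + 16R`

`WeightDataGeometry.lean` proves `Monotone`, `Local`, `Additive`, `StrongDominated` for the weight
data of a finite-range decomposition with box-density indicators and thickenings, from inequalities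
between abstract radii.  Here the radii of [ABKM19] Ch. 6.2 / (7.2) are fixed and those
inequalities are discharged from the single condition (7.9) `L ≥ 2^{d+3} + 16R` (with
`M_ord ≤ R`, `M_ord ≤ L`, `R ≥ 2`):

* `boxRad R L k` (`R` at `k = 0`, `2L^k` for `k ≥ 1`: the box of `χ_k^X`, so that `χ_X ≥ 1` on
  `X⁺ = X + [−L^k,L^k]^d` for `k`-polymers), `boxWt L d k = L^{−kd}`, `starRad R L d k` (the radius
  of `X*`: `R`, `2^d + R`, `2^dL^{k−1}` at scales `0`, `1`, `k ≥ 2`, (6.25)), `nbRad R L k` (`2R`,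
  `3L^k`: the locality set, `X^{++}` of Lemma 7.5 (iii) enlarged by `L^k` to hold the box), the
  separations `sepRadF L k = L^k + 1` ("strictly disjoint": `dist > L^k`) and
  `sepRadM L k = ⌈¾L^{k+1}⌉` (Theorem 7.1 (w4)), `thetaMax R d = (2R+1)^d` ((7.3) `θ_max`);
* `abkmWeightData L N Mord R θ̄ δ' 𝒞` — `geomWeightData` with these radii, derivative orders
  `s = {1 ≤ |α| ≤ M_ord}` and multipliers `f κ j = 𝒞̂_j(κ)` of a kernel family `𝒞`;
* `boxDensity_abkm_le` (`χ_k^X ≤ θ_max`), `one_le_boxDensity_abkm` (`χ_k^X ≥ 1` on `X⁺` for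
  `k`-polymers, via `TorusBlocks`), **`monotone_abkmWeightData`**, **`local_abkmWeightData`**,
  **`strongDominated_abkmWeightData`**, and **`additive_abkmWeightData`** — the last from the
  evenness and FINITE RANGE of the kernels (`𝒞_j(x) = const` for `|x|_∞ ≥ L^j/2`, `j ≤ N`: clause
  (iii) of `GradientFRD.TorusFRD`) via `circulant_separates_of_separated` ((7.58)) and the
  vacuity of `¾L^{k+1}`-separation at scales `k ≥ N`.

Everything is proved; no named fact.  What is NOT here: `Dominated` (see `WeightDataOfFRD`), the
trace bound (w7) and Lemma 7.8 (w9).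

## References
* S. Adams, S. Buchholz, R. Kotecký, S. Müller, arXiv:1910.13564, (6.25), (7.2)–(7.3), (7.9),
  Lemma 7.5 (iii),(iv), Lemma 7.6, Theorem 7.1 (w1), (w3)–(w6) [AdamsBuchholzKoteckyMuller2019].
-/

noncomputable section

namespace Literature.MathematicalPhysics.StatisticalMechanics.GradientRG

open Finset Matrix
open scoped MatrixOrder
open Literature.MathematicalPhysics.StatisticalMechanics.TorusPolymer
  (ball thicken Separated mem_ball mem_thicken thicken_mono thicken_empty IsPolymer blockOf)
open Literature.MathematicalPhysics.StatisticalMechanics.GradientFRD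
  (supNorm mulMat fourierCoeff cExt cExt_of_mem circulant_eq_mulMat mulMat_smul posSemidef_mulMat)

variable {d M : ℕ} [NeZero M]

/-! ## The radii -/

/-- Radius of the box of `χ_k^X`: `R` at scale `0` (`B⁺ = B + [−R,R]^d`), `2L^k` for `k ≥ 1`.
[cite: AdamsBuchholzKoteckyMuller2019, Ch. 7.1 (7.2)] -/
def boxRad (R L : ℕ) : ℕ → ℕ
  | 0 => R
  | k + 1 => 2 * L ^ (k + 1)

/-- Weight per point of the box density, `L^{−kd}` (one unit per `k`-block).
[cite: AdamsBuchholzKoteckyMuller2019, Ch. 7.1 (7.2)] -/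
def boxWt (L : ℝ) (d k : ℕ) : ℝ := (L ^ (k * d))⁻¹

/-- Radius of the small-set neighbourhood `X*` of a scale-`k` polymer ((6.25)): `R`, `2^d + R`,
`2^dL^{k−1}` at scales `0`, `1`, `k ≥ 2`. [cite: AdamsBuchholzKoteckyMuller2019, Ch. 6.2 (6.25)] -/
def starRad (R L d : ℕ) : ℕ → ℕ
  | 0 => R
  | 1 => 2 ^ d + R
  | k + 2 => 2 ^ d * L ^ (k + 1)

/-- Radius of the locality set at scale `k`: `2R` at scale `0` (`X^{++}`), `3L^k` for `k ≥ 1`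
(`X^{++} = X + [−2L^k,2L^k]^d` of Lemma 7.5 (iii), enlarged to hold the box of `χ_k^X`).
[cite: AdamsBuchholzKoteckyMuller2019, Lemma 7.5 (iii)] -/
def nbRad (R L : ℕ) : ℕ → ℕ
  | 0 => 2 * R
  | k + 1 => 3 * L ^ (k + 1)

/-- Radius of the large neighbourhood `X⁺` ((6.25)): `R` at scale `0`, `L^k` for `k ≥ 1`.
[cite: AdamsBuchholzKoteckyMuller2019, Ch. 6.2 (6.25)] -/
def plusRad (R L : ℕ) : ℕ → ℕ
  | 0 => R
  | k + 1 => L ^ (k + 1)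

/-- "Strictly disjoint at scale `k`": `dist_∞ > L^k`. [cite: AdamsBuchholzKoteckyMuller2019, Ch. 6.2] -/
def sepRadF (L k : ℕ) : ℕ := L ^ k + 1

/-- The separation `dist_∞ ≥ ¾L^{k+1}` of Theorem 7.1 (w4), as the integer `⌈¾L^{k+1}⌉`.
[cite: AdamsBuchholzKoteckyMuller2019, Theorem 7.1 (w4)] -/
def sepRadM (L k : ℕ) : ℕ := ⌈(3 / 4 : ℝ) * (L : ℝ) ^ (k + 1)⌉₊

/-- `θ_max = (2R+1)^d` ((7.3)). [cite: AdamsBuchholzKoteckyMuller2019, Ch. 7.1 (7.3)] -/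
def thetaMax (R d : ℕ) : ℝ := ((2 * R + 1 : ℕ) : ℝ) ^ d

/-- `⌈¾L^{k+1}⌉` is within `1` of `¾L^{k+1}`. [cite: AdamsBuchholzKoteckyMuller2019, Theorem 7.1 (w4)] -/
theorem sepRadM_spec (L k : ℕ) :
    (3 / 4 : ℝ) * (L : ℝ) ^ (k + 1) ≤ sepRadM L k ∧
      (sepRadM L k : ℝ) < (3 / 4 : ℝ) * (L : ℝ) ^ (k + 1) + 1 :=
  ⟨Nat.le_ceil _, Nat.ceil_lt_add_one (by positivity)⟩

/-- Integer distances `≥ ¾L^{k+1}` are exactly those `≥ sepRadM`. [cite: AdamsBuchholzKoteckyMuller2019, Theorem 7.1 (w4)] -/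
theorem sepRadM_le_iff {L k D : ℕ} : sepRadM L k ≤ D ↔ (3 / 4 : ℝ) * (L : ℝ) ^ (k + 1) ≤ D :=
  Nat.ceil_le

/-! ## The concrete data -/

/-- **The weight data of [ABKM19] (7.2)–(7.5) on `(ℤ/M)^d`** for a kernel family `𝒞_j`
(`j = 1,…,N+1`): `geomWeightData` with orders `1 ≤ |α| ≤ M_ord`, `θ_max = (2R+1)^d`, box
densities of radius `boxRad`, weight `L^{−kd}`, enlargement radius `starRad`, multipliers `𝒞̂_j`.
[cite: AdamsBuchholzKoteckyMuller2019, Ch. 7.1 (7.5)] -/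
def abkmWeightData (L N Mord R : ℕ) (θbar : ℝ) (δ' : ℕ → ℝ) (𝒞 : ℕ → (Fin d → ZMod M) → ℝ) :
    WeightData (Fin d → ZMod M) :=
  geomWeightData (L : ℝ) N (diffIndex d Mord) θbar (thetaMax R d) δ'
    (fun κ j => fourierCoeff (𝒞 j) κ) (boxRad R L) (boxWt (L : ℝ) d) (starRad R L d)

/-- **`χ_k^X ≤ θ_max`** for the box densities of `abkmWeightData` (`R ≥ 2`, `L ≥ 1`).
[cite: AdamsBuchholzKoteckyMuller2019, Ch. 7.1 (7.3)] -/
theorem boxDensity_abkm_le {R L : ℕ} (hR : 2 ≤ R) (hL : 1 ≤ L) (k : ℕ)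
    (X : Finset (Fin d → ZMod M)) (x : Fin d → ZMod M) :
    boxDensity (boxRad R L k) (boxWt (L : ℝ) d k) X x ≤ thetaMax R d := by
  have hw : 0 ≤ boxWt (L : ℝ) d k := by unfold boxWt; positivity
  refine (boxDensity_le _ hw X x).trans ?_
  cases k with
  | zero =>
    simp only [boxRad, boxWt, zero_mul, pow_zero, inv_one, one_mul, thetaMax]
    push_cast; exact le_rfl
  | succ k =>
    simp only [boxRad, boxWt, thetaMax]
    have hLk : (1 : ℝ) ≤ (L : ℝ) ^ (k + 1) := one_le_pow₀ (by exact_mod_cast hL)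
    have hpos : (0 : ℝ) < (L : ℝ) ^ ((k + 1) * d) := by positivity
    -- `(4L^k + 1)^d / L^{kd} ≤ 5^d ≤ (2R+1)^d`
    have h1 : (2 * ((2 * L ^ (k + 1) : ℕ) : ℝ) + 1) ^ d ≤ (5 * (L : ℝ) ^ (k + 1)) ^ d := by
      refine pow_le_pow_left₀ (by positivity) ?_ d
      push_cast; linarith
    have h2 : (5 : ℝ) ^ d ≤ ((2 * R + 1 : ℕ) : ℝ) ^ d :=
      pow_le_pow_left₀ (by norm_num) (by exact_mod_cast (show 5 ≤ 2 * R + 1 by omega)) d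
    calc ((L : ℝ) ^ ((k + 1) * d))⁻¹ * (2 * ((2 * L ^ (k + 1) : ℕ) : ℝ) + 1) ^ d
        ≤ ((L : ℝ) ^ ((k + 1) * d))⁻¹ * (5 * (L : ℝ) ^ (k + 1)) ^ d :=
          mul_le_mul_of_nonneg_left h1 (by positivity)
      _ = 5 ^ d := by rw [mul_pow, ← pow_mul, mul_comm ((5 : ℝ) ^ d), ← mul_assoc,
          inv_mul_cancel₀ hpos.ne', one_mul]
      _ ≤ _ := h2

/-- `θ_max > 0`. [cite: AdamsBuchholzKoteckyMuller2019, Ch. 7.1 (7.3)] -/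
theorem thetaMax_pos (R d : ℕ) : 0 < thetaMax R d := by unfold thetaMax; positivity

/-- **`χ_k^X ≥ 1` on `X⁺` for `k`-polymers** (the box of radius `boxRad_k` about a point of
`X⁺ = X + [−plusRad_k, plusRad_k]^d` contains a whole `k`-block of `X`, of `L^{kd}` points; at scale
`0` it contains a point of `X`): the property `χ_X ≥ 1_{X⁺}` of [ABKM19]'s `Σ_{B∈𝓑_k(X)} 1_{B⁺}`
used in (7.60) and Lemma 7.8. Torus side `M = L^N`, `L` odd, `k ≤ N`.
[cite: AdamsBuchholzKoteckyMuller2019, Lemma 7.6 (7.60)] -/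
theorem one_le_boxDensity_abkm {L N R k : ℕ} (hLodd : Odd L) (hM : M = L ^ N) (hk : k ≤ N)
    {X : Finset (Fin d → ZMod M)} (hX : IsPolymer (L ^ k) X) {x : Fin d → ZMod M}
    (hx : x ∈ thicken (plusRad R L k) X) :
    1 ≤ boxDensity (boxRad R L k) (boxWt (L : ℝ) d k) X x := by
  cases k with
  | zero =>
    -- a point of `X` within distance `R`
    obtain ⟨y, hy, hxy⟩ := mem_thicken.1 hx
    have h := le_boxDensity_of_subset (ρ := boxRad R L 0) (w := boxWt (L : ℝ) d 0) (by unfold boxWt; positivity)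
      (Finset.singleton_subset_iff.2 hy) (B := {y}) (x := x)
      (Finset.singleton_subset_iff.2 (by rw [TorusPolymer.mem_ball_comm, mem_ball]; exact hxy))
    simpa [boxWt] using h
  | succ k =>
    -- a whole `(k+1)`-block of `X` inside the box
    have hs : Odd (L ^ (k + 1)) := hLodd.pow
    obtain ⟨y, -, hBX, hBx⟩ := hX.exists_block_subset hs hx
    have hM' : M = L ^ (k + 1) * L ^ (N - (k + 1)) := by rw [hM, ← pow_add]; congr 1; omega
    have hcard := TorusPolymer.card_blockOf hM' hs hLodd.pow y
    have hBx' : blockOf (L ^ (k + 1)) y ⊆ ball (boxRad R L (k + 1)) x := fun z hz => by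
      have := mem_ball.1 (hBx hz)
      rw [mem_ball]; simp only [plusRad, boxRad] at this ⊢; omega
    have h := le_boxDensity_of_subset (w := boxWt (L : ℝ) d (k + 1)) (by unfold boxWt; positivity)
      hBX hBx'
    rw [hcard] at h
    refine le_trans (le_of_eq ?_) h
    rw [boxWt, Nat.cast_pow, Nat.cast_pow, ← pow_mul, inv_mul_cancel₀]
    exact pow_ne_zero _ (by exact_mod_cast hLodd.pos.ne')

/-- **Lemma 7.5 (iv) / Theorem 7.1 (w1) input**: `abkmWeightData` is `Monotone`.
[cite: AdamsBuchholzKoteckyMuller2019, Lemma 7.5 (iv)] -/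
theorem monotone_abkmWeightData (L N Mord R : ℕ) (θbar : ℝ) {δ' : ℕ → ℝ} (hδ : ∀ k, 0 ≤ δ' k)
    (𝒞 : ℕ → (Fin d → ZMod M) → ℝ) : (abkmWeightData L N Mord R θbar δ' 𝒞).Monotone :=
  monotone_geomWeightData (Nat.cast_nonneg L) N _ θbar (thetaMax_pos R d) hδ _ _
    (fun k => by unfold boxWt; positivity) _

/-- **Lemma 7.5 (iii)**: `abkmWeightData` is `Local` for the locality sets `X + [−nbRad_k, nbRad_k]^d`
(`1 ≤ M_ord ≤ R`, `M_ord ≤ L`, `2^d + 3R ≤ 3L`). [cite: AdamsBuchholzKoteckyMuller2019, Lemma 7.5 (iii)] -/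
theorem local_abkmWeightData {L Mord R : ℕ} (N : ℕ) (hMord : 1 ≤ Mord) (hMR : Mord ≤ R)
    (hML : Mord ≤ L) (hL : 2 ^ d + 3 * R ≤ 3 * L) (θbar : ℝ) (δ' : ℕ → ℝ)
    (𝒞 : ℕ → (Fin d → ZMod M) → ℝ) :
    (abkmWeightData L N Mord R θbar δ' 𝒞).Local fun k X => thicken (nbRad R L k) X := by
  refine local_geomWeightData (L : ℝ) N hMord (fun α hα => (mem_diffIndex.1 hα).1)
    (fun α hα => (mem_diffIndex.1 hα).2) θbar _ δ' _ _ (fun k => ?_) fun k => ?_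
  · cases k with
    | zero => simp only [boxRad, nbRad]; omega
    | succ k =>
      simp only [boxRad, nbRad]
      have : Mord ≤ L ^ (k + 1) := hML.trans (Nat.le_self_pow (by omega) L)
      omega
  · cases k with
    | zero => simp only [nbRad, starRad, zero_add, pow_one]; omega
    | succ k =>
      simp only [nbRad, starRad]
      have h1 : (2 ^ d + 3) * L ^ (k + 1) ≤ 3 * L * L ^ (k + 1) :=
        Nat.mul_le_mul_right _ (by omega)
      rw [pow_succ L (k + 1)]
      nlinarith [h1]

/-- **Lemma 7.6 (ii) inputs**: `abkmWeightData` is `StrongDominated` for the strong forms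
`G_k^X = g_k Σ_{α∈s'} L^{2k(|α|−1)}(∇^α)ᵀχ_k^X∇^α`, `s' ⊆ {1 ≤ |α| ≤ M_ord}`, `g_k ≤ δ'_k/θ_max`
(in [ABKM19] `s' = {1 ≤ |α| ≤ ⌊d/2⌋+1}`, `g_k = h_k⁻²`, (7.60)), and disjointness.
[cite: AdamsBuchholzKoteckyMuller2019, Lemma 7.6 (ii)] -/
theorem strongDominated_abkmWeightData (L N : ℕ) {Mord : ℕ} (R : ℕ) (θbar : ℝ) {δ' : ℕ → ℝ}
    (hδ : ∀ k, 0 ≤ δ' k) (𝒞 : ℕ → (Fin d → ZMod M) → ℝ) {s' : Finset (Fin d → ℕ)}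
    (hs' : s' ⊆ diffIndex d Mord) {g : ℕ → ℝ} (hg : ∀ k, g k ≤ δ' k / thetaMax R d) :
    (abkmWeightData L N Mord R θbar δ' 𝒞).StrongDominated
      (fun k X => g k • derivForm (L : ℝ) k s' (boxDensity (boxRad R L k) (boxWt (L : ℝ) d k) X))
      fun _ X Y => Disjoint X Y :=
  strongDominated_geomWeightData (Nat.cast_nonneg L) N hs' θbar (thetaMax_pos R d) hδ _ _
    (fun k => by unfold boxWt; positivity) _ hg

/-! ## Finite range ⇒ additivity (Lemma 7.6 (i)) -/

omit [NeZero M] in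
/-- Separation by a scalar multiple. [cite: AdamsBuchholzKoteckyMuller2019, Lemma 7.6 (i) (7.58)] -/
theorem _root_.Matrix.Separates.smul [Fintype (Fin d → ZMod M)] {C : Matrix (Fin d → ZMod M) (Fin d → ZMod M) ℝ}
    {S T : Finset (Fin d → ZMod M)} (h : C.Separates S T) (c : ℝ) : (c • C).Separates S T := by
  intro v hv hsum
  obtain ⟨c₀, hc₀⟩ := h v hv hsum
  exact ⟨c * c₀, fun x hx => by rw [Matrix.smul_mulVec, Pi.smul_apply, hc₀ x hx, smul_eq_mul]⟩

omit [NeZero M] in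
/-- Everything separates from the empty set. [cite: AdamsBuchholzKoteckyMuller2019, Theorem 7.1 (w4)] -/
theorem _root_.Matrix.separates_of_eq_empty [Fintype (Fin d → ZMod M)]
    (C : Matrix (Fin d → ZMod M) (Fin d → ZMod M) ℝ) {S T : Finset (Fin d → ZMod M)}
    (h : S = ∅ ∨ T = ∅) : C.Separates S T := by
  intro v hv hsum
  rcases h with h | h
  · exact ⟨0, fun x hx => by rw [h] at hx; exact absurd hx (Finset.notMem_empty x)⟩
  · refine ⟨0, fun x _ => ?_⟩
    have hv0 : v = 0 := funext fun y => hv y (by rw [h]; exact Finset.notMem_empty y)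
    rw [hv0, Matrix.mulVec_zero, Pi.zero_apply]

/-- **A kernel constant beyond range `r` separates `r`-separated sets** ((7.58): "the kernel of
`𝒞_{k+1}` is constant for `|x|_∞ ≥ L^{k+1}/2`"): `circulant 𝒢` maps zero-sum fields supported in `T`
to fields constant on `S` whenever `dist_∞(S,T) ≥ D ≥ r`.
[cite: AdamsBuchholzKoteckyMuller2019, Lemma 7.6 (i) (7.58)] -/
theorem circulant_separates_of_separated {𝒢 : (Fin d → ZMod M) → ℝ} {c₀ r : ℝ}
    (h𝒢 : ∀ z : Fin d → ZMod M, r ≤ (supNorm z : ℝ) → 𝒢 z = c₀) {S T : Finset (Fin d → ZMod M)}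
    {D : ℕ} (hST : Separated D S T) (hD : r ≤ D) : (Matrix.circulant 𝒢).Separates S T := by
  intro v hv hsum
  refine ⟨0, fun x hx => ?_⟩
  have hterm : ∀ y, 𝒢 (x - y) * v y = c₀ * v y := fun y => by
    by_cases hy : y ∈ T
    · rw [h𝒢 _ (hD.trans (by exact_mod_cast hST x hx y hy))]
    · rw [hv y hy, mul_zero, mul_zero]
  simp only [Matrix.mulVec, dotProduct, Matrix.circulant_apply, hterm, ← Finset.mul_sum, hsum,
    mul_zero]

/-- The step covariance of `abkmWeightData` is `(1+θ̄)·circulant 𝒞_{k+1}` for even kernels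
(`k + 1 ≤ N + 1`). [cite: AdamsBuchholzKoteckyMuller2019, Ch. 7.1 (7.5)] -/
theorem abkmWeightData_cov_eq {L N Mord R : ℕ} {θbar : ℝ} {δ' : ℕ → ℝ}
    {𝒞 : ℕ → (Fin d → ZMod M) → ℝ} {k : ℕ} (hk : k + 1 ≤ N + 1)
    (heven : ∀ x, 𝒞 (k + 1) (-x) = 𝒞 (k + 1) x) :
    (abkmWeightData L N Mord R θbar δ' 𝒞).cov k = (1 + θbar) • Matrix.circulant (𝒞 (k + 1)) := by
  rw [abkmWeightData, geomWeightData_cov, circulant_eq_mulMat heven, ← mulMat_smul]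
  congr 1; funext κ
  rw [cExt_of_mem (by omega) hk]

/-- The radii inequalities behind Lemma 7.6 (i) for `L ≥ 2^{d+3} + 16R`: `1 ≤ a_k ≤ b_k`,
`b_k + 2r_{k+1} ≤ a_{k+1}` ((7.56)), `2n_k + L^{k+1}/2 ≤ b_k` ((7.58)), `L^N < 2b_N`.
[cite: AdamsBuchholzKoteckyMuller2019, Lemma 7.6 (i) (7.56)] -/
theorem sepRad_ineqs {L R : ℕ} (hR : 1 ≤ R) (hL : 2 ^ (d + 3) + 16 * R ≤ L) (k : ℕ) :
    1 ≤ sepRadF L k ∧ sepRadF L k ≤ sepRadM L k ∧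
      sepRadM L k + starRad R L d (k + 1) + starRad R L d (k + 1) ≤ sepRadF L (k + 1) ∧
      2 * nbRad R L k ≤ sepRadM L k ∧
      ((L : ℝ) ^ (k + 1)) / 2 ≤ ((sepRadM L k - 2 * nbRad R L k : ℕ) : ℝ) ∧
      L ^ k < 2 * sepRadM L k := by
  obtain ⟨hb1, hb2⟩ := sepRadM_spec L k
  have h8 : (8 : ℝ) ≤ 2 ^ (d + 3) := by
    have : (2 : ℝ) ^ 3 ≤ 2 ^ (d + 3) := pow_le_pow_right₀ (by norm_num) (by omega)
    norm_num at this; exact this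
  have h28 : (2 : ℝ) ^ (d + 3) = 2 ^ d * 8 := by rw [pow_add]; norm_num
  have hR1 : (1 : ℝ) ≤ R := by exact_mod_cast hR
  have hLr : (2 : ℝ) ^ (d + 3) + 16 * R ≤ L := by exact_mod_cast hL
  have hL24 : (24 : ℝ) ≤ L := by linarith
  have hLk : (1 : ℝ) ≤ (L : ℝ) ^ k := one_le_pow₀ (by linarith)
  have hX : (L : ℝ) ^ (k + 1) = L * (L : ℝ) ^ k := by rw [pow_succ, mul_comm]
  -- `8 r_{k+1} ≤ L^{k+1}` and `8 n_k ≤ L^{k+1}`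
  have hr : 8 * (starRad R L d (k + 1) : ℝ) ≤ (L : ℝ) ^ (k + 1) := by
    cases k with
    | zero =>
      simp only [starRad, zero_add, pow_one]; push_cast
      have : (0 : ℝ) ≤ 2 ^ d := by positivity
      nlinarith
    | succ j =>
      simp only [starRad]; push_cast
      rw [pow_succ (L : ℝ) (j + 1), mul_comm ((L : ℝ) ^ (j + 1))]
      have hLj : (0 : ℝ) ≤ (L : ℝ) ^ (j + 1) := by positivity
      have : 8 * (2 : ℝ) ^ d ≤ L := by nlinarith
      nlinarith
  have hn : 8 * (nbRad R L k : ℝ) ≤ (L : ℝ) ^ (k + 1) := by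
    cases k with
    | zero => simp only [nbRad, zero_add, pow_one]; push_cast; nlinarith
    | succ j =>
      simp only [nbRad]; push_cast
      rw [pow_succ (L : ℝ) (j + 1), mul_comm ((L : ℝ) ^ (j + 1))]
      have hLj : (0 : ℝ) ≤ (L : ℝ) ^ (j + 1) := by positivity
      nlinarith
  have haF : (sepRadF L k : ℝ) = (L : ℝ) ^ k + 1 := by unfold sepRadF; push_cast; ring
  have haF' : (sepRadF L (k + 1) : ℝ) = (L : ℝ) ^ (k + 1) + 1 := by
    unfold sepRadF; push_cast; ring
  refine ⟨by unfold sepRadF; omega, ?_, ?_, ?_, ?_, ?_⟩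
  · exact_mod_cast (show (sepRadF L k : ℝ) ≤ sepRadM L k by rw [haF]; nlinarith)
  · have : (sepRadM L k : ℝ) + starRad R L d (k + 1) + starRad R L d (k + 1) < sepRadF L (k + 1) + 1 := by
      rw [haF']; nlinarith
    exact_mod_cast Nat.lt_add_one_iff.1 (by exact_mod_cast this)
  · exact_mod_cast (show (2 * nbRad R L k : ℝ) ≤ sepRadM L k by nlinarith)
  · have h2n : 2 * nbRad R L k ≤ sepRadM L k := by
      exact_mod_cast (show (2 * nbRad R L k : ℝ) ≤ sepRadM L k by nlinarith)
    rw [Nat.cast_sub h2n]; push_cast; nlinarith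
  · have : ((L : ℝ) ^ k) < 2 * sepRadM L k := by nlinarith
    exact_mod_cast this

/-- **Lemma 7.6 (i) / Theorem 7.1 (w3), (w4) inputs**: `abkmWeightData` is `Additive` for the
locality sets `X + [−nbRad_k, nbRad_k]^d`, "strictly disjoint" = `dist_∞ > L^k` and
`dist_∞ ≥ ¾L^{k+1}`, provided `L ≥ 2^{d+3} + 16R`, `M = L^N`, the kernels `𝒞_j` (`j ≤ N+1`) are
even with non-negative multipliers, and `𝒞_j` is constant beyond `|x|_∞ ≥ L^j/2` for `j ≤ N`
(finite range, `GradientFRD.TorusFRD` (iii)). [cite: AdamsBuchholzKoteckyMuller2019, Lemma 7.6 (i)] -/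
theorem additive_abkmWeightData {L N Mord R : ℕ} (hR : 1 ≤ R) (hL : 2 ^ (d + 3) + 16 * R ≤ L)
    (hM : M = L ^ N)
    {θbar : ℝ} (hθbar : 0 ≤ 1 + θbar) (δ' : ℕ → ℝ) {𝒞 : ℕ → (Fin d → ZMod M) → ℝ}
    (heven : ∀ j, 1 ≤ j → j ≤ N + 1 → ∀ x, 𝒞 j (-x) = 𝒞 j x)
    (hnn : ∀ j κ, 0 ≤ cExt N (fun j => fourierCoeff (𝒞 j) κ) j)
    (hfr : ∀ j, 1 ≤ j → j ≤ N → ∃ c : ℝ, ∀ x : Fin d → ZMod M,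
      ((L : ℝ) ^ j) / 2 ≤ (supNorm x : ℝ) → 𝒞 j x = c) :
    (abkmWeightData L N Mord R θbar δ' 𝒞).Additive (fun k X => thicken (nbRad R L k) X)
      (fun k X Y => Separated (sepRadF L k) X Y) fun k X Y => Separated (sepRadM L k) X Y := by
  refine additive_geomWeightData (L : ℝ) N _ θbar _ δ' _ _ _ (fun k => (sepRad_ineqs hR hL k).1)
    (fun k => (sepRad_ineqs hR hL k).2.1) (fun k => (sepRad_ineqs hR hL k).2.2.1)
    (fun k X Y hXY => ?_) fun k => ?_
  · -- finite range below the last scale, vacuity at and beyond it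
    obtain ⟨-, -, -, h2n, hc, hlast⟩ := sepRad_ineqs (d := d) hR hL k
    by_cases hk : k + 1 ≤ N
    · obtain ⟨c, hc𝒞⟩ := hfr (k + 1) (by omega) hk
      change ((abkmWeightData L N Mord R θbar δ' 𝒞).cov k).Separates _ _
      rw [abkmWeightData_cov_eq (by omega) (heven (k + 1) (by omega) (by omega))]
      refine (circulant_separates_of_separated hc𝒞 (D := sepRadM L k - 2 * nbRad R L k) ?_ hc).smul _
      have hsplit : sepRadM L k = (sepRadM L k - 2 * nbRad R L k) + nbRad R L k + nbRad R L k := by omega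
      rw [hsplit] at hXY
      exact hXY.thicken
    · -- `k ≥ N`: two `¾L^{k+1}`-separated sets on the torus of side `L^N` cannot both be non-empty
      refine Matrix.separates_of_eq_empty _ ?_
      have hL1 : 1 ≤ L := le_trans Nat.one_le_two_pow (le_trans (Nat.le_add_right _ _) hL)
      have hNk : L ^ N ≤ L ^ k := Nat.pow_le_pow_right hL1 (by omega)
      rcases hXY.eq_empty_or_eq_empty (by rw [hM]; omega) with h | h
      · left; rw [h]; exact thicken_empty _
      · right; rw [h]; exact thicken_empty _
  · change ((abkmWeightData L N Mord R θbar δ' 𝒞).cov k).PosSemidef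
    rw [abkmWeightData, geomWeightData_cov]
    exact posSemidef_mulMat fun κ => mul_nonneg hθbar (hnn (k + 1) κ)

end Literature.MathematicalPhysics.StatisticalMechanics.GradientRG

end
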